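import Mathlib
import Summits.NavierStokesRegularity.NavierStokesRegularity.Theorems.WakeRatchetTailRatchetDSSAmplitudeFloor
import Summits.NavierStokesRegularity.NavierStokesRegularity.Theorems.WakeRatchetTailRatchetSmallAmplitudeLiouville
import Summits.NavierStokesRegularity.NavierStokesRegularity.Theses.TaoLadderRungTwoBreak
import HarnessLib

/-!
# K2(1) `TaoLadderRungTwoBreak.BlowupRigidityOne` (stmt-NavierStokesRegularity-20206): BOTH OBJECTS OF THE
  CLASSIFICATION STUB ARE LARGE — the surviving eternal solution it receives and the DSS wave it must return
  have renormalised amplitude `> 1/(896 ε₀)`; K1(1) holds on every amplitude-bounded class of waves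

MODEL lattice ODEs only (Tao 2016 §4 (4.8) in the self-similar variables of §6.4; cell vocabulary
`IsEternal` / `EternalSurvivingFwd` / `IsDSSWave` / `Surviving` / `sMass`); nothing in this file is a statement
about the Navier–Stokes equations, and NO item is closed by it (`--supports stmt-NavierStokesRegularity-20206`).
DEF-FREE.

The registered skeleton `9d85f4d387c689cd` of K2(1) splits the crux into the extraction stub
`stub_eternalFromBlowup` (robust blow-up ⇒ a forward (S₁)-surviving admissible eternal solution `W`) and the
classification stub `stub_eternalIsDSS` (such a `W` on an `E₂(R)` table ⇒ a non-trivial (S₁)-surviving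
admissible DSS wave `Φ`).  The WakeRatchet programme landed, for EVERY cancelling `R`-comparable table and
every `0 < ε₀ ≤ 1`, the sharp amplitude floor of admissible eternal solutions and DSS waves
(`WakeRatchetEternalFloor.eq_zero_of_small_bound_sharp`, `WakeRatchetSmallAmplitudeLiouville.surviving_large`,
`WakeRatchetDSSAmplitudeFloor.dssWave_exists_large_mass`: the global balance `∫E = (Λ − Λ⁻¹)∫F` against the
flux bound `|F| ≤ C_A·E·sup Σ‖Φ_r‖`, `C_A ≤ 64`, `Λ − Λ⁻¹ < 14ε₀`).  This file writes those theorems in the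
currency of items 20206 / 20205 (never cited there before):

* `survivingEternal_large` — the INPUT of `stub_eternalIsDSS` is large: a forward (S₁)-surviving admissible
  eternal solution of an `E₂(R)` table at ratio `1+ε₀ ≤ 2` has `‖W_n(σ)‖ > 1/(896 ε₀)` somewhere;
* `dssWitness_large` — the OUTPUT of `stub_eternalIsDSS` / of the crux is large: a non-trivial admissible DSS
  wave of an `E₂(R)` table has a phase with summed amplitude `Σ_r ‖Φ_r(x)‖ > 1/(896 ε₀)` (surviving or not);
* `noSurvivingDSSOne_boundedSlice` — **K1(1) ON EVERY AMPLITUDE-BOUNDED CLASS**: for every bound `C > 0` and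
  every spread `R`, below the EXPLICIT threshold `εs = min 1 (1/(896 C))` no `E₂(R)` table carries a non-trivial
  admissible DSS wave with `Σ_r‖Φ_r‖ ≤ C` — with NO survival hypothesis; `noSurvivingDSSOne_of_bound` is the
  literal K1(1)-shaped corollary (survival clause idle);
* `blowupRigidityOne_iff_large`, `stubEternalIsDSS_iff_large` — BY NAME: the route decl `BlowupRigidityOne`
  and the REGISTERED signature of `stub_eternalIsDSS` (verbatim) are equivalent to their «large» forms (input
  carrying a shell value `> 1/(896 ε₀)`, output carrying a phase of summed amplitude `> 1/(896 ε₀)`).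

READING FOR THE CENSUS of 20206: the classification stub is a statement about LARGE objects only — type-I
constant `≳ ε₀⁻¹` on both sides — so no perturbative (small-solution) classification and no `ε₀`-uniform
compactness class can deliver it; together with `…UnitaryGapClosed` (the `μ < 1` clause is automatic) the
stub's content is: «a large surviving eternal solution forces a large wave with `μ ≥ (1+ε₀)⁻¹`».
HONEST LABEL: bookkeeping over landed theorems of another route; no stub, crux or summit is proved; rung 0.
-/

noncomputable section

-- the summit and its single sub-problem share the name (CONVENTIONS §1)
set_option linter.dupNamespace false

namespace Summit.NavierStokesRegularity.NavierStokesRegularity.Theorems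

namespace BlowupRigidityOne

open MeasureTheory Set Filter Topology
open Literature.Analysis.FluidPDE Literature.Analysis.FluidPDE.TaoCascade
open Summit.NavierStokesRegularity.NavierStokesRegularity.Theses.TaoLadderRungTwoBreak

variable {ε₀ R : ℝ} {α : Fin 4 → Fin 4 → Fin 4 → ℤ × ℤ × ℤ → ℝ}

/-- **The input of the classification stub is large.**  On an `E₂(R)` table at scale ratio `1+ε₀`,
`0 < ε₀ ≤ 1`, a forward (S₁)-surviving admissible (inviscid) eternal solution has a shell value of norm
`> 1/(896 ε₀)` (WakeRatchet's `surviving_large` at `ν̂ = 0`, `a = 1`).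
[cite: Tao2016AveragedNS, §4 (4.1)–(4.3), Lemma 4.1 (4.8)–(4.10), §6.4; cell theorem] -/
theorem survivingEternal_large (hε : 0 < ε₀) (hε1 : ε₀ ≤ 1) (hα : InTableClass R α)
    {W : ℤ → ℝ → Em 4} (hW : IsEternal ε₀ α W) (hs : EternalSurvivingFwd 1 ε₀ W) :
    ∃ (n : ℤ) (σ : ℝ), 1 / (896 * ε₀) < ‖W n σ‖ :=
  WakeRatchetSmallAmplitudeLiouville.surviving_large hε hε1 hα hW.isEternalVisc hs

/-- **The output of the classification stub / of the crux is large.**  On an `E₂(R)` table at scale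
ratio `1+ε₀`, `0 < ε₀ ≤ 1`, a non-trivial admissible DSS wave (any period, shape permutation, delay;
surviving or not) has a phase `x` with `Σ_r ‖Φ_r(x)‖ > 1/(896 ε₀)` (WakeRatchet's
`dssWave_exists_large_mass`). [cite: Tao2016AveragedNS, §4 (4.1)–(4.3), Lemma 4.1 (4.8)–(4.10), §6.4; cell theorem] -/
theorem dssWitness_large (hε : 0 < ε₀) (hε1 : ε₀ ≤ 1) (hα : InTableClass R α)
    {q : ℕ} {π : Equiv.Perm (Fin q)} {T : ℝ} {Φ : Fin q → ℝ → Em 4} (hW : IsDSSWave ε₀ α π T Φ)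
    (hne : ∃ r x, Φ r x ≠ 0) : ∃ x, 1 / (896 * ε₀) < sMass Φ x :=
  WakeRatchetDSSAmplitudeFloor.dssWave_exists_large_mass hε hε1 hα.2.1 hα.2.2 hW hne

/-- **K1(1) on every amplitude-bounded class, explicit threshold.**  For every bound `C > 0` and every
spread `R`: with `εs = min 1 (1/(896 C))`, for all `ε₀ ∈ (0, εs]` and every table of `E₂(R)`, every
admissible DSS wave whose summed amplitude obeys `Σ_r ‖Φ_r(x)‖ ≤ C` for all `x` is trivial — no survival
hypothesis is needed. [cite: Tao2016AveragedNS, §4 (4.1)–(4.3), Lemma 4.1 (4.8)–(4.10), §6.4; cell theorem] -/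
theorem noSurvivingDSSOne_boundedSlice {C : ℝ} (hC : 0 < C) (R : ℝ) :
    ∃ εs : ℝ, 0 < εs ∧ ∀ ε₀ : ℝ, 0 < ε₀ → ε₀ ≤ εs →
      ∀ α : Fin 4 → Fin 4 → Fin 4 → ℤ × ℤ × ℤ → ℝ, InTableClass R α →
        ∀ (q : ℕ) (π : Equiv.Perm (Fin q)) (T : ℝ) (Φ : Fin q → ℝ → Em 4),
          IsDSSWave ε₀ α π T Φ → (∀ x, sMass Φ x ≤ C) → ∀ r x, Φ r x = 0 := by
  refine ⟨min 1 (1 / (896 * C)), lt_min one_pos (by positivity), ?_⟩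
  intro ε₀ hε hle α hα q π T Φ hW hM
  have hε1 : ε₀ ≤ 1 := hle.trans (min_le_left _ _)
  have hεC : ε₀ ≤ 1 / (896 * C) := hle.trans (min_le_right _ _)
  -- `C ≤ 1/(896 ε₀)` because `896 ε₀ C ≤ 1`
  have hCle : C ≤ 1 / (896 * ε₀) := by
    rw [le_div_iff₀ (by positivity)] at hεC ⊢
    linarith
  exact WakeRatchetDSSAmplitudeFloor.dssWave_eq_zero_of_mass_le hε hε1 hα.2.1 hα.2.2 hW
    fun x => (hM x).trans hCle

/-- **The K1(1)-shaped corollary**: in the vocabulary of the aside `NoSurvivingDSSOne`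
(stmt-NavierStokesRegularity-20205) — for every `C > 0` and `R`, below `min 1 (1/(896 C))` every
(S₁)-surviving admissible DSS wave of an `E₂(R)` table with `Σ_r ‖Φ_r‖ ≤ C` is trivial (the survival clause
is idle). [cite: Tao2016AveragedNS, §4 Thm. 4.2 (statement shape), §6.4; cell theorem] -/
theorem noSurvivingDSSOne_of_bound {C : ℝ} (hC : 0 < C) (R : ℝ) :
    ∃ εs : ℝ, 0 < εs ∧ ∀ ε₀ : ℝ, 0 < ε₀ → ε₀ ≤ εs →
      ∀ α : Fin 4 → Fin 4 → Fin 4 → ℤ × ℤ × ℤ → ℝ, InTableClass R α →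
        ∀ (q : ℕ) (π : Equiv.Perm (Fin q)) (T : ℝ) (Φ : Fin q → ℝ → Em 4),
          IsDSSWave ε₀ α π T Φ → Surviving 1 ε₀ T → (∀ x, sMass Φ x ≤ C) → ∀ r x, Φ r x = 0 := by
  obtain ⟨εs, hεs, H⟩ := noSurvivingDSSOne_boundedSlice hC R
  exact ⟨εs, hεs, fun ε₀ hε hle α hα q π T Φ hW _ hM => H ε₀ hε hle α hα q π T Φ hW hM⟩

/-- **BY NAME: the crux is equivalent to its «large-output» form** — the non-trivial (S₁)-surviving
admissible DSS wave that `BlowupRigidityOne` asks for automatically carries a phase of summed amplitude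
`> 1/(896 ε₀)` (threshold shrunk to `≤ 1`). [cite: Tao2016AveragedNS, §4 Thm. 4.2 (statement shape), §6.4; cell theorem] -/
theorem blowupRigidityOne_iff_large :
    BlowupRigidityOne ↔
      ∀ R : ℝ, 1 ≤ R → ∃ εs : ℝ, 0 < εs ∧ ∀ ε₀ : ℝ, 0 < ε₀ → ε₀ ≤ εs →
        ∀ (α : Fin 4 → Fin 4 → Fin 4 → ℤ × ℤ × ℤ → ℝ) (X₀ : Fin 4 → ℝ),
          InTableClass R α → NoGlobalCascade ε₀ α X₀ →
            ∃ (q : ℕ) (π : Equiv.Perm (Fin q)) (T : ℝ) (Φ : Fin q → ℝ → Em 4),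
              IsDSSWave ε₀ α π T Φ ∧ Surviving 1 ε₀ T ∧ (∃ r x, Φ r x ≠ 0) ∧
                ∃ x, 1 / (896 * ε₀) < sMass Φ x := by
  constructor
  · intro h R hR
    obtain ⟨εs, hεs, H⟩ := h R hR
    refine ⟨min εs 1, lt_min hεs one_pos, fun ε₀ hε hle α X₀ hα hNG => ?_⟩
    obtain ⟨q, π, T, Φ, hW, hS, hne⟩ := H ε₀ hε (hle.trans (min_le_left _ _)) α X₀ hα hNG
    exact ⟨q, π, T, Φ, hW, hS, hne,
      dssWitness_large hε (hle.trans (min_le_right _ _)) hα hW hne⟩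
  · intro h R hR
    obtain ⟨εs, hεs, H⟩ := h R hR
    refine ⟨εs, hεs, fun ε₀ hε hle α X₀ hα hNG => ?_⟩
    obtain ⟨q, π, T, Φ, hW, hS, hne, -⟩ := H ε₀ hε hle α X₀ hα hNG
    exact ⟨q, π, T, Φ, hW, hS, hne⟩

/-- **BY NAME: the registered classification stub `stub_eternalIsDSS` (signature verbatim, left) is
equivalent to its «large» form** — hypothesis restricted to surviving eternal solutions with a shell value
of norm `> 1/(896 ε₀)`, conclusion strengthened by a phase of summed amplitude `> 1/(896 ε₀)`: both
restrictions are automatic below `ε₀ ≤ 1`. [cite: Tao2016AveragedNS, §4 Thm. 4.2 (statement shape), §6.4; cell theorem] -/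
theorem stubEternalIsDSS_iff_large :
    (∀ R : ℝ, 1 ≤ R → ∃ εs : ℝ, 0 < εs ∧ ∀ ε₀ : ℝ, 0 < ε₀ → ε₀ ≤ εs →
      ∀ α : (Fin 4 → Fin 4 → Fin 4 → ℤ × ℤ × ℤ → ℝ), InTableClass R α →
        (∃ W : ℤ → ℝ → Em 4, IsEternal ε₀ α W ∧ EternalSurvivingFwd 1 ε₀ W) →
          ∃ (q : ℕ) (π : Equiv.Perm (Fin q)) (T : ℝ) (Φ : Fin q → ℝ → Em 4),
            IsDSSWave ε₀ α π T Φ ∧ Surviving 1 ε₀ T ∧ ∃ r x, Φ r x ≠ 0) ↔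
    (∀ R : ℝ, 1 ≤ R → ∃ εs : ℝ, 0 < εs ∧ ∀ ε₀ : ℝ, 0 < ε₀ → ε₀ ≤ εs →
      ∀ α : (Fin 4 → Fin 4 → Fin 4 → ℤ × ℤ × ℤ → ℝ), InTableClass R α →
        (∃ W : ℤ → ℝ → Em 4, IsEternal ε₀ α W ∧ EternalSurvivingFwd 1 ε₀ W ∧
            ∃ (n : ℤ) (σ : ℝ), 1 / (896 * ε₀) < ‖W n σ‖) →
          ∃ (q : ℕ) (π : Equiv.Perm (Fin q)) (T : ℝ) (Φ : Fin q → ℝ → Em 4),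
            IsDSSWave ε₀ α π T Φ ∧ Surviving 1 ε₀ T ∧ (∃ r x, Φ r x ≠ 0) ∧
              ∃ x, 1 / (896 * ε₀) < sMass Φ x) := by
  constructor
  · intro h R hR
    obtain ⟨εs, hεs, H⟩ := h R hR
    refine ⟨min εs 1, lt_min hεs one_pos, fun ε₀ hε hle α hα hW => ?_⟩
    obtain ⟨W, hE, hs, -⟩ := hW
    obtain ⟨q, π, T, Φ, hD, hS, hne⟩ := H ε₀ hε (hle.trans (min_le_left _ _)) α hα ⟨W, hE, hs⟩
    exact ⟨q, π, T, Φ, hD, hS, hne, dssWitness_large hε (hle.trans (min_le_right _ _)) hα hD hne⟩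
  · intro h R hR
    obtain ⟨εs, hεs, H⟩ := h R hR
    refine ⟨min εs 1, lt_min hεs one_pos, fun ε₀ hε hle α hα hW => ?_⟩
    obtain ⟨W, hE, hs⟩ := hW
    have hε1 : ε₀ ≤ 1 := hle.trans (min_le_right _ _)
    obtain ⟨q, π, T, Φ, hD, hS, hne, -⟩ :=
      H ε₀ hε (hle.trans (min_le_left _ _)) α hα ⟨W, hE, hs, survivingEternal_large hε hε1 hα hE hs⟩
    exact ⟨q, π, T, Φ, hD, hS, hne⟩

end BlowupRigidityOne

end Summit.NavierStokesRegularity.NavierStokesRegularity.Theorems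

end
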